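import Literature.Probability.LatticeModels.TorusGreenHessianDecay
import Summits.QuantumFields.YangMills.Theorems.SelfNormalisedSkewness.Negative.TreeLevelSkewnessVanishes
import Summits.QuantumFields.YangMills.Theorems.ScalingWindowSplitSelfNormalisedSkewnessStubRangeProjectionKernel
import HarnessLib

/-!
# Crux `SelfNormalisedSkewness` (stmt-QuantumFields-18944, route `ScalingWindowSplit`), line `Sketch`:
# stub `stub_ringTraceBound`

Stub K-ring of the negation branch (the `U(1)` super-weak witness). In the witness the Gaussian
third cumulant of the `O(4)`-scalar plaquette composite at three sites `x, y, z` is a constant times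
the odd ring `∑ π(n₁)_{αα'} π(n₂)_{α'α''} π(n₃)_{α''α}` over the planes `α, α', α''` of `Fin 4`,
where `π(n) = ½ K(Hess G̃(n))` is the lattice `F`-propagator (`stub_rangeProjectionKernel`),
`Hess_{ij}G̃(n) = G̃(n+eᵢ) - G̃(n+eᵢ-eⱼ) - G̃(n) + G̃(n-eⱼ)`, `G̃ = torusGreen` the zero-mode-free Green
function of `(ℤ/S)⁴`, and `K` is the plane–plane covariance of `TreeLevelSkewnessVanishes.lean`.

We prove the quantitative bound

`|ring(n₁, n₂, n₃)| ≤ C Σ_cyc (d₁⁻⁵ + S⁻⁴) d₂⁻⁴ d₃⁻⁴`, `dᵢ = dist(0, nᵢ)` (centred coordinates),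

for all non-zero `n₁, n₂, n₃`, with `C` independent of `S`, GIVEN the third-difference estimate
`|Hess_{ij}G̃(z) - Hess_{ij}G̃(z - e_k)| ≤ C₁ (dist⁻⁵ + S⁻⁴)` (hypothesis `hC`, which is literally the
landed `stub_torusGreenThirdDiff`).

## Proof

* `sum_planes_eq`: the planes `{(μ, ν) // μ < ν}` are enumerated by `Fin 6` through `(p1, p2)`, and
  in this enumeration `π(n) = ½ K(M)`, `M = Matrix.of (Hess G̃(n))`; so the ring is
  `⅛ tr K(M₁)K(M₂)K(M₃)` (`trace_mul_mul_eq`).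
* `site_decomp`: `M = Mₛ + R`, `Mₛ = ½(M + Mᵀ) - (tr M/4)·1` symmetric traceless,
  `R = ½(M - Mᵀ) + (tr M/4)·1`. Here `tr M = ∑_μ Hess_{μμ} = -(-ΔG̃)(n) = 2/S⁴` exactly for `n ≠ 0`
  (`RangeProjectionKernel.torusGreen_negLaplacian`), and `Hess_{μρ} - Hess_{ρμ}` is a difference of
  two third differences (`antisymm_identity`), so `|R| ≤ (C₁ + 1)(d⁻⁵ + S⁻⁴)`; while
  `|M| ≤ C₀ d⁻⁴` (`torusGreen_hessian_mul_dist_pow_four_le`, using `1 ≤ d ≤ S`).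
* `tr K(Mₛ,₁)K(Mₛ,₂)K(Mₛ,₃) = 0` (`treeLevelSkewness_vanishes`), and telescoping
  `tr A₁A₂A₃ = tr E₁A₂A₃ + tr B₁E₂A₃ + tr B₁B₂E₃ + tr B₁B₂B₃` (`Aᵢ = Bᵢ + Eᵢ`, `Bᵢ = K Mₛ,ᵢ`,
  `Eᵢ = K Rᵢ`) with `|tr XYZ| ≤ 6³ max|X| max|Y| max|Z|` (`abs_trace_mul_mul_le`).

Elementary; no named facts are used. The file introduces no definitions.
-/

noncomputable section

open scoped BigOperators
open Literature.Probability.LatticeModels (TorusSite torusGreen two_mul_abs_valMinAbs_le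
  torusGreen_hessian_mul_dist_pow_four_le)

namespace Summit.QuantumFields.YangMills.Theorems.SelfNormalisedSkewness.Negative

/-- Each of the six coordinate planes `01, 02, 03, 12, 13, 23` (`p1`, `p2`) is increasing. [folklore] -/
private theorem p1_lt_p2 : ∀ a : Fin 6, p1 a < p2 a := by decide

/-- Reindexing a sum over the planes `{(μ, ν) // μ < ν}` of `Fin 4` along the enumeration
`a ↦ (p1 a, p2 a)` of `Fin 6`. [folklore] -/
private theorem sum_planes_eq (φ : {q : Fin 4 × Fin 4 // q.1 < q.2} → ℝ) :
    ∑ α, φ α = ∑ a : Fin 6, φ ⟨(p1 a, p2 a), p1_lt_p2 a⟩ := by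
  refine (Function.Bijective.sum_comp (e := fun a : Fin 6 =>
    (⟨(p1 a, p2 a), p1_lt_p2 a⟩ : {q : Fin 4 × Fin 4 // q.1 < q.2})) ⟨?_, ?_⟩ φ).symm
  · have key : ∀ a b : Fin 6, p1 a = p1 b → p2 a = p2 b → a = b := by decide
    intro a b hab
    exact key a b (congrArg (fun q : {q : Fin 4 × Fin 4 // q.1 < q.2} => q.1.1) hab)
      (congrArg (fun q : {q : Fin 4 × Fin 4 // q.1 < q.2} => q.1.2) hab)
  · have key : ∀ μ ν : Fin 4, μ < ν → ∃ a : Fin 6, p1 a = μ ∧ p2 a = ν := by decide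
    rintro ⟨⟨μ, ν⟩, hμν⟩
    obtain ⟨a, ha1, ha2⟩ := key μ ν hμν
    exact ⟨a, Subtype.ext (Prod.ext ha1 ha2)⟩

/-- `K` is compatible with subtraction (it is `ℝ`-linear in `h`). [folklore] -/
private theorem K_sub (h₁ h₂ : Matrix (Fin 4) (Fin 4) ℝ) : K (h₁ - h₂) = K h₁ - K h₂ := by
  ext a b
  simp only [K, Matrix.sub_apply]
  ring

/-- Entry bound for `K h`: four terms, each a product of an entry of `h` and a Kronecker delta.
[folklore] -/
private theorem abs_K_apply_le {h : Matrix (Fin 4) (Fin 4) ℝ} {x : ℝ} (hx : ∀ i j, |h i j| ≤ x)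
    (a b : Fin 6) : |K h a b| ≤ 4 * x := by
  have hδ : ∀ i j, |δ i j| ≤ 1 := by
    intro i j
    unfold δ
    split_ifs <;> simp
  have h0 : 0 ≤ x := (abs_nonneg _).trans (hx 0 0)
  have ht : ∀ i j k l, |h i j * δ k l| ≤ x := by
    intro i j k l
    rw [abs_mul]
    calc |h i j| * |δ k l| ≤ x * 1 := mul_le_mul (hx i j) (hδ k l) (abs_nonneg _) h0
      _ = x := mul_one x
  have hK : K h a b = -(h (p1 a) (p1 b) * δ (p2 a) (p2 b)) + h (p1 a) (p2 b) * δ (p2 a) (p1 b)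
      + h (p2 a) (p1 b) * δ (p1 a) (p2 b) - h (p2 a) (p2 b) * δ (p1 a) (p1 b) := by
    simp only [K, neg_mul]
  rw [hK]
  calc _ ≤ |-(h (p1 a) (p1 b) * δ (p2 a) (p2 b)) + h (p1 a) (p2 b) * δ (p2 a) (p1 b)
        + h (p2 a) (p1 b) * δ (p1 a) (p2 b)| + |h (p2 a) (p2 b) * δ (p1 a) (p1 b)| := abs_sub _ _
    _ ≤ |-(h (p1 a) (p1 b) * δ (p2 a) (p2 b))| + |h (p1 a) (p2 b) * δ (p2 a) (p1 b)|
        + |h (p2 a) (p1 b) * δ (p1 a) (p2 b)| + |h (p2 a) (p2 b) * δ (p1 a) (p1 b)| :=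
        add_le_add (abs_add_three _ _ _) le_rfl
    _ ≤ x + x + x + x := by
        rw [abs_neg]
        exact add_le_add (add_le_add (add_le_add (ht _ _ _ _) (ht _ _ _ _)) (ht _ _ _ _))
          (ht _ _ _ _)
    _ = 4 * x := by ring

/-- The trace of a triple product of `6 × 6` matrices as a triple sum. [folklore] -/
private theorem trace_mul_mul_eq (X Y Z : Matrix (Fin 6) (Fin 6) ℝ) :
    Matrix.trace (X * Y * Z) = ∑ a, ∑ b, ∑ c, X a b * Y b c * Z c a := by
  simp only [Matrix.trace, Matrix.diag_apply, Matrix.mul_apply, Finset.sum_mul]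
  exact Finset.sum_congr rfl fun a _ => Finset.sum_comm

/-- `|tr(XYZ)| ≤ 6³ · max|X| · max|Y| · max|Z|` for `6 × 6` matrices. [folklore] -/
private theorem abs_trace_mul_mul_le {X Y Z : Matrix (Fin 6) (Fin 6) ℝ} {x y z : ℝ}
    (hX : ∀ a b, |X a b| ≤ x) (hY : ∀ a b, |Y a b| ≤ y) (hZ : ∀ a b, |Z a b| ≤ z) :
    |Matrix.trace (X * Y * Z)| ≤ 216 * (x * y * z) := by
  rw [trace_mul_mul_eq]
  have hx : 0 ≤ x := (abs_nonneg _).trans (hX 0 0)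
  have hy : 0 ≤ y := (abs_nonneg _).trans (hY 0 0)
  calc |∑ a, ∑ b, ∑ c, X a b * Y b c * Z c a| ≤ ∑ a, ∑ b, ∑ c, |X a b * Y b c * Z c a| := by
        refine (Finset.abs_sum_le_sum_abs _ _).trans (Finset.sum_le_sum fun a _ => ?_)
        refine (Finset.abs_sum_le_sum_abs _ _).trans (Finset.sum_le_sum fun b _ => ?_)
        exact Finset.abs_sum_le_sum_abs _ _
    _ ≤ ∑ _a : Fin 6, ∑ _b : Fin 6, ∑ _c : Fin 6, x * y * z := by
        refine Finset.sum_le_sum fun a _ => Finset.sum_le_sum fun b _ =>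
          Finset.sum_le_sum fun c _ => ?_
        rw [abs_mul, abs_mul]
        exact mul_le_mul (mul_le_mul (hX a b) (hY b c) (abs_nonneg _) hx) (hZ c a) (abs_nonneg _)
          (mul_nonneg hx hy)
    _ = 216 * (x * y * z) := by
        simp only [Finset.sum_const, Finset.card_univ, Fintype.card_fin]
        ring

/-- For `n ≠ 0` in `(ℤ/S)⁴` the centred Euclidean distance to `0` is at least `1`. [folklore] -/
private theorem one_le_tdist {S : ℕ} {n : TorusSite 4 S} (hn : n ≠ 0) :
    1 ≤ Real.sqrt (∑ μ, (((n μ).valMinAbs : ℤ) : ℝ) ^ 2) := by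
  obtain ⟨μ, hμ⟩ := Function.ne_iff.1 hn
  have h1 : (n μ).valMinAbs ≠ 0 := fun h => hμ ((ZMod.valMinAbs_eq_zero _).1 h)
  have h2 : (1 : ℝ) ≤ (((n μ).valMinAbs : ℤ) : ℝ) ^ 2 := by
    rw [one_le_sq_iff_one_le_abs, ← Int.cast_abs]
    exact_mod_cast Int.one_le_abs h1
  rw [Real.one_le_sqrt]
  exact h2.trans (Finset.single_le_sum (f := fun k => (((n k).valMinAbs : ℤ) : ℝ) ^ 2)
    (fun k _ => sq_nonneg _) (Finset.mem_univ μ))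

/-- The centred Euclidean distance on `(ℤ/S)⁴` is at most `S` (each centred coordinate is at most
`S/2` in absolute value). [folklore] -/
private theorem tdist_le {S : ℕ} [NeZero S] (n : TorusSite 4 S) :
    Real.sqrt (∑ μ, (((n μ).valMinAbs : ℤ) : ℝ) ^ 2) ≤ S := by
  have hμ : ∀ μ, (((n μ).valMinAbs : ℤ) : ℝ) ^ 2 ≤ ((S : ℝ) / 2) ^ 2 := by
    intro μ
    have h := two_mul_abs_valMinAbs_le (n μ)
    have h' : 2 * |(((n μ).valMinAbs : ℤ) : ℝ)| ≤ (S : ℝ) := by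
      rw [← Int.cast_abs]
      exact_mod_cast h
    rw [← sq_abs]
    exact pow_le_pow_left₀ (abs_nonneg _) (by linarith) 2
  have hsum : ∑ μ, (((n μ).valMinAbs : ℤ) : ℝ) ^ 2 ≤ (S : ℝ) ^ 2 :=
    calc ∑ μ, (((n μ).valMinAbs : ℤ) : ℝ) ^ 2 ≤ ∑ _μ : Fin 4, ((S : ℝ) / 2) ^ 2 :=
          Finset.sum_le_sum fun μ _ => hμ μ
      _ = (S : ℝ) ^ 2 := by
          simp only [Finset.sum_const, Finset.card_univ, Fintype.card_fin]
          ring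
  calc _ ≤ Real.sqrt ((S : ℝ) ^ 2) := Real.sqrt_le_sqrt hsum
    _ = S := Real.sqrt_sq (Nat.cast_nonneg S)

/-- An eight-point identity on an additive group: the antisymmetric part of the mixed second
difference `∇ᵤ⁺∇ᵥ⁻G(n) - ∇ᵥ⁺∇ᵤ⁻G(n)` is a difference of two third differences
`∇ᵥ⁻[∇ᵤ⁺∇ᵤ⁻G](n) - ∇ᵤ⁻[∇ᵥ⁺∇ᵥ⁻G](n)`. [folklore] -/
private theorem antisymm_identity {V : Type*} [AddCommGroup V] (G : V → ℝ) (n u v : V) :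
    (G (n + u) - G (n + u - v) - G n + G (n - v)) - (G (n + v) - G (n + v - u) - G n + G (n - u)) =
      ((G (n + u) - G (n + u - u) - G n + G (n - u)) -
          (G (n - v + u) - G (n - v + u - u) - G (n - v) + G (n - v - u))) -
        ((G (n + v) - G (n + v - v) - G n + G (n - v)) -
          (G (n - u + v) - G (n - u + v - v) - G (n - u) + G (n - u - v))) := by
  have e1 : n - v + u = n + u - v := by abel
  have e2 : n - u + v = n + v - u := by abel
  have e3 : n - v - u = n - u - v := by abel
  have e4 : n - v + u - u = n - v := by abel
  have e5 : n - u + v - v = n - u := by abel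
  have e6 : n + u - u = n := by abel
  have e7 : n + v - v = n := by abel
  rw [e4, e5, e6, e7, e1, e2, e3]
  ring

/-- **Per-site decomposition of the lattice Hessian.** For `n ≠ 0` write the Hessian matrix
`M = (Hess_{ij} G̃(n))` as `M = Mₛ + R` with `Mₛ = ½(M + Mᵀ) - (tr M / 4)·1` symmetric and
traceless and `R = ½(M - Mᵀ) + (tr M / 4)·1`; then `K M = K Mₛ + K R`, the entries of `K M` and
`K Mₛ` are `O(dist⁻⁴)` (Calderón–Zygmund bound `hC₀`, `dist ≤ S`) and the entries of `K R` are
`O(dist⁻⁵ + S⁻⁴)`: `tr M = 2/S⁴` exactly (`-ΔG̃ = 2δ₀ - 2/S⁴`) and the antisymmetric part of `M` is a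
difference of third differences (`antisymm_identity`, bound `hC₁`). [folklore] -/
private theorem site_decomp {S : ℕ} [NeZero S] {C₀ C₁ : ℝ}
    (hC₀ : ∀ (i j : Fin 4) (z : TorusSite 4 S), z ≠ 0 →
      |torusGreen (z + Pi.single i 1) - torusGreen (z + Pi.single i 1 - Pi.single j 1) -
          torusGreen z + torusGreen (z - Pi.single j 1)| *
        Real.sqrt (∑ k, (((z k).valMinAbs : ℤ) : ℝ) ^ 2) ^ 4 ≤ C₀)
    (hC₁ : ∀ (i j k : Fin 4) (z : TorusSite 4 S), z ≠ 0 →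
      |(torusGreen (z + Pi.single i 1) - torusGreen (z + Pi.single i 1 - Pi.single j 1) -
          torusGreen (z) + torusGreen (z - Pi.single j 1)) -
        (torusGreen ((z - Pi.single k 1 : TorusSite 4 S) + Pi.single i 1) -
          torusGreen ((z - Pi.single k 1 : TorusSite 4 S) + Pi.single i 1 - Pi.single j 1) -
          torusGreen ((z - Pi.single k 1 : TorusSite 4 S)) +
          torusGreen ((z - Pi.single k 1 : TorusSite 4 S) - Pi.single j 1))| ≤
        C₁ * ((Real.sqrt (∑ μ, (((z μ).valMinAbs : ℤ) : ℝ) ^ 2) ^ 5)⁻¹ + ((S : ℝ) ^ 4)⁻¹))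
    (H : TorusSite 4 S → Fin 4 → Fin 4 → ℝ)
    (hH : ∀ z i j, H z i j = torusGreen (z + Pi.single i 1) -
      torusGreen (z + Pi.single i 1 - Pi.single j 1) - torusGreen z + torusGreen (z - Pi.single j 1))
    {n : TorusSite 4 S} (hn : n ≠ 0) :
    ∃ Ms R : Matrix (Fin 4) (Fin 4) ℝ, Ms.IsSymm ∧ Ms.trace = 0 ∧
      K (Matrix.of (H n)) = K Ms + K R ∧
      (∀ a b, |K (Matrix.of (H n)) a b| ≤
        (4 * |C₀| + 8 * |C₁| + 8) * (Real.sqrt (∑ μ, (((n μ).valMinAbs : ℤ) : ℝ) ^ 2))⁻¹ ^ 4) ∧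
      (∀ a b, |K Ms a b| ≤
        (4 * |C₀| + 8 * |C₁| + 8) * (Real.sqrt (∑ μ, (((n μ).valMinAbs : ℤ) : ℝ) ^ 2))⁻¹ ^ 4) ∧
      (∀ a b, |K R a b| ≤ 4 * ((|C₁| + 1) *
        ((Real.sqrt (∑ μ, (((n μ).valMinAbs : ℤ) : ℝ) ^ 2))⁻¹ ^ 5 + ((S : ℝ) ^ 4)⁻¹))) := by
  -- the distance `d`, `D = d⁻⁴`, `ε = d⁻⁵ + S⁻⁴`
  set d : ℝ := Real.sqrt (∑ μ, (((n μ).valMinAbs : ℤ) : ℝ) ^ 2)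
  have hd1 : 1 ≤ d := one_le_tdist hn
  have hd0 : 0 < d := one_pos.trans_le hd1
  have hdS : d ≤ S := tdist_le n
  have hS0 : (0 : ℝ) < S := hd0.trans_le hdS
  set D : ℝ := d⁻¹ ^ 4 with hD
  set ε : ℝ := d⁻¹ ^ 5 + ((S : ℝ) ^ 4)⁻¹ with hε
  have hdi0 : 0 ≤ d⁻¹ := inv_nonneg.2 hd0.le
  have hdi1 : d⁻¹ ≤ 1 := inv_le_one_of_one_le₀ hd1
  have hD0 : 0 ≤ D := pow_nonneg hdi0 4
  have hS4D : ((S : ℝ) ^ 4)⁻¹ ≤ D := by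
    rw [hD, inv_pow]
    exact inv_anti₀ (by positivity) (pow_le_pow_left₀ hd0.le hdS 4)
  have hd5D : d⁻¹ ^ 5 ≤ D := pow_le_pow_of_le_one hdi0 hdi1 (by norm_num)
  have hS40 : (0 : ℝ) ≤ ((S : ℝ) ^ 4)⁻¹ := by positivity
  have hε0 : 0 ≤ ε := add_nonneg (pow_nonneg hdi0 5) hS40
  have hSε : ((S : ℝ) ^ 4)⁻¹ ≤ ε := by rw [hε]; linarith [pow_nonneg hdi0 5]
  have hεD : ε ≤ 2 * D := by rw [hε]; linarith
  -- the trace of the Hessian: `∑_μ Hess_{μμ} = -(-ΔG̃)(n) = 2/S⁴`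
  have htrH : ∑ μ, H n μ μ = 2 / (S : ℝ) ^ 4 := by
    have h := RangeProjectionKernel.torusGreen_negLaplacian n
    rw [if_neg hn, mul_zero, zero_sub] at h
    have h2 : ∑ μ, H n μ μ = -∑ μ, (2 * torusGreen n - torusGreen (n + Pi.single μ 1) -
        torusGreen (n - Pi.single μ 1)) := by
      rw [← Finset.sum_neg_distrib]
      refine Finset.sum_congr rfl fun μ _ => ?_
      rw [hH, add_sub_cancel_right]
      ring
    rw [h2, h, neg_neg]
  -- third differences and the antisymmetric part
  have h3 : ∀ i k, |H n i i - H (n - Pi.single k 1) i i| ≤ |C₁| * ε := by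
    intro i k
    have h := hC₁ i i k n hn
    rw [← inv_pow _ 5] at h
    rw [hH, hH]
    exact h.trans (mul_le_mul_of_nonneg_right (le_abs_self C₁) hε0)
  have hanti : ∀ μ ρ, |H n μ ρ - H n ρ μ| ≤ 2 * |C₁| * ε := by
    intro μ ρ
    have hid : H n μ ρ - H n ρ μ = (H n μ μ - H (n - Pi.single ρ 1) μ μ) -
        (H n ρ ρ - H (n - Pi.single μ 1) ρ ρ) := by
      simp only [hH]
      exact antisymm_identity (torusGreen (d := 4) (L := S)) n (Pi.single μ 1) (Pi.single ρ 1)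
    rw [hid]
    calc _ ≤ |H n μ μ - H (n - Pi.single ρ 1) μ μ| + |H n ρ ρ - H (n - Pi.single μ 1) ρ ρ| :=
          abs_sub _ _
      _ ≤ |C₁| * ε + |C₁| * ε := add_le_add (h3 μ ρ) (h3 ρ μ)
      _ = 2 * |C₁| * ε := by ring
  -- the matrices
  set M : Matrix (Fin 4) (Fin 4) ℝ := Matrix.of (H n) with hMdef
  have hM : ∀ i j, |M i j| ≤ |C₀| * D := by
    intro i j
    have h : |H n i j| * d ^ 4 ≤ |C₀| := by
      rw [hH]
      exact (hC₀ i j n hn).trans (le_abs_self C₀)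
    rw [hMdef, Matrix.of_apply, hD, inv_pow, ← div_eq_mul_inv, le_div_iff₀ (by positivity)]
    exact h
  have htrM : M.trace = 2 / (S : ℝ) ^ 4 := by
    simp only [hMdef, Matrix.trace, Matrix.diag_apply, Matrix.of_apply]
    exact htrH
  set R : Matrix (Fin 4) (Fin 4) ℝ :=
    (1 / 2 : ℝ) • (M - M.transpose) + (M.trace / 4) • (1 : Matrix (Fin 4) (Fin 4) ℝ) with hRdef
  have hR : ∀ i j, |R i j| ≤ (|C₁| + 1) * ε := by
    intro i j
    have h1 : |(1 : Matrix (Fin 4) (Fin 4) ℝ) i j| ≤ 1 := by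
      rw [Matrix.one_apply]
      split_ifs <;> simp
    simp only [hRdef, Matrix.add_apply, Matrix.smul_apply, Matrix.sub_apply, Matrix.transpose_apply,
      smul_eq_mul, htrM]
    simp only [hMdef, Matrix.of_apply]
    calc _ ≤ |1 / 2 * (H n i j - H n j i)| +
          |2 / (S : ℝ) ^ 4 / 4 * (1 : Matrix (Fin 4) (Fin 4) ℝ) i j| := abs_add_le _ _
      _ = 1 / 2 * |H n i j - H n j i| +
          2 / (S : ℝ) ^ 4 / 4 * |(1 : Matrix (Fin 4) (Fin 4) ℝ) i j| := by
          rw [abs_mul, abs_mul, abs_of_pos (by norm_num : (0 : ℝ) < 1 / 2),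
            abs_of_nonneg (by positivity : (0 : ℝ) ≤ 2 / (S : ℝ) ^ 4 / 4)]
      _ ≤ 1 / 2 * (2 * |C₁| * ε) + 2 / (S : ℝ) ^ 4 / 4 * 1 :=
          add_le_add (mul_le_mul_of_nonneg_left (hanti i j) (by norm_num))
            (mul_le_mul_of_nonneg_left h1 (by positivity))
      _ = |C₁| * ε + ((S : ℝ) ^ 4)⁻¹ / 2 := by ring
      _ ≤ (|C₁| + 1) * ε := by linarith
  have hMs : ∀ i j, |(M - R) i j| ≤ (|C₀| + 2 * |C₁| + 2) * D := by
    intro i j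
    rw [Matrix.sub_apply]
    have h := mul_le_mul_of_nonneg_left hεD (by positivity : (0 : ℝ) ≤ |C₁| + 1)
    calc |M i j - R i j| ≤ |M i j| + |R i j| := abs_sub _ _
      _ ≤ |C₀| * D + (|C₁| + 1) * ε := add_le_add (hM i j) (hR i j)
      _ ≤ (|C₀| + 2 * |C₁| + 2) * D := by linarith
  refine ⟨M - R, R, ?_, ?_, ?_, ?_, ?_, ?_⟩
  · -- symmetric
    refine Matrix.IsSymm.ext fun i j => ?_
    rcases eq_or_ne i j with rfl | hij
    · rfl
    · simp only [hRdef, Matrix.sub_apply, Matrix.add_apply, Matrix.smul_apply,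
        Matrix.transpose_apply, smul_eq_mul, Matrix.one_apply_ne hij,
        Matrix.one_apply_ne hij.symm]
      ring
  · -- traceless
    simp only [hRdef, Matrix.trace_sub, Matrix.trace_add, Matrix.trace_smul,
      Matrix.trace_transpose, Matrix.trace_one, Fintype.card_fin, smul_eq_mul, Nat.cast_ofNat]
    ring
  · rw [K_sub, sub_add_cancel]
  · intro a b
    refine (abs_K_apply_le hM a b).trans ?_
    have := mul_nonneg (abs_nonneg C₁) hD0
    linarith
  · intro a b
    refine (abs_K_apply_le hMs a b).trans (le_of_eq ?_)
    ring
  · intro a b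
    exact abs_K_apply_le hR a b

/-- **Stub `stub_ringTraceBound`** (K-ring) of line `Sketch`, crux `SelfNormalisedSkewness`
(stmt-QuantumFields-18944), registered signature verbatim. The odd ring
`∑_{α α' α''} π(n₁)_{αα'} π(n₂)_{α'α''} π(n₃)_{α''α}` of the lattice `F`-propagator
`π(n) = ½ K(Hess G̃(n))` (planes `α = (μ < ν)` of `Fin 4`) is bounded by
`C Σ_cyc (d₁⁻⁵ + S⁻⁴) d₂⁻⁴ d₃⁻⁴`, `dᵢ = dist(0, nᵢ)`. Proof: reindex the planes by `Fin 6`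
(`sum_planes_eq`), so the ring is `⅛ tr K(M₁)K(M₂)K(M₃)`; split `Mᵢ = Mₛ,ᵢ + Rᵢ` (`site_decomp`);
the purely symmetric-traceless ring vanishes (`treeLevelSkewness_vanishes`: `K(h)` anticommutes with
the Hodge star), and each of the three telescoping remainders contains one factor `K(Rᵢ)` of size
`O(dᵢ⁻⁵ + S⁻⁴)` against two factors of size `O(d⁻⁴)`. [folklore] -/
theorem stub_ringTraceBound (hC : ∃ C : ℝ, ∀ (L : ℕ) [NeZero L] (i j k : Fin 4) (z : TorusSite 4 L), z ≠ 0 → |(torusGreen (z + Pi.single i 1) - torusGreen (z + Pi.single i 1 - Pi.single j 1) - torusGreen (z) + torusGreen (z - Pi.single j 1)) - (torusGreen ((z - Pi.single k 1 : TorusSite 4 L) + Pi.single i 1) - torusGreen ((z - Pi.single k 1 : TorusSite 4 L) + Pi.single i 1 - Pi.single j 1) - torusGreen ((z - Pi.single k 1 : TorusSite 4 L)) + torusGreen ((z - Pi.single k 1 : TorusSite 4 L) - Pi.single j 1))| ≤ C * ((Real.sqrt (∑ μ, (((z μ).valMinAbs : ℤ) : ℝ) ^ 2) ^ 5)⁻¹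 + ((L : ℝ) ^ 4)⁻¹)) : ∃ C : ℝ, ∀ (S : ℕ) [NeZero S], ∀ (H : TorusSite 4 S → Fin 4 → Fin 4 → ℝ), (∀ z i j, H z i j = torusGreen (z + Pi.single i 1) - torusGreen (z + Pi.single i 1 - Pi.single j 1) - torusGreen z + torusGreen (z - Pi.single j 1)) → ∀ (πK : TorusSite 4 S → {q : Fin 4 × Fin 4 // q.1 < q.2} → {q : Fin 4 × Fin 4 // q.1 < q.2} → ℝ), (∀ n α α', πK n α α' = (1 / 2 : ℝ) * (-(H n α.1.1 α'.1.1) * (if α.1.2 = α'.1.2 then 1 else 0) + H n α.1.1 α'.1.2 * (if α.1.2 = α'.1.1 then 1 else 0) + H n α.1.2 α'.1.1 * (if α.1.1 = α'.1.2 then 1 else 0) - H n α.1.2 α'.1.2 * (if α.1.1 = α'.1.1 then 1 else 0))) → ∀ (n₁ n₂ n₃ : TorusSite 4 S), n₁ ≠ 0 → n₂ ≠ 0 → n₃ ≠ 0 → |∑ α, ∑ α', ∑ α'', πK n₁ α α' * πK n₂ α' α'' * πK n₃ α'' α| ≤ C * (((Real.sqrt (∑ μ, (((n₁ μ).valMinAbs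 : ℤ) : ℝ) ^ 2))⁻¹ ^ 5 + ((S : ℝ) ^ 4)⁻¹) * (Real.sqrt (∑ μ, (((n₂ μ).valMinAbs : ℤ) : ℝ) ^ 2))⁻¹ ^ 4 * (Real.sqrt (∑ μ, (((n₃ μ).valMinAbs : ℤ) : ℝ) ^ 2))⁻¹ ^ 4 + ((Real.sqrt (∑ μ, (((n₂ μ).valMinAbs : ℤ) : ℝ) ^ 2))⁻¹ ^ 5 + ((S : ℝ) ^ 4)⁻¹) * (Real.sqrt (∑ μ, (((n₁ μ).valMinAbs : ℤ) : ℝ) ^ 2))⁻¹ ^ 4 * (Real.sqrt (∑ μ, (((n₃ μ).valMinAbs : ℤ) : ℝ) ^ 2))⁻¹ ^ 4 + ((Real.sqrt (∑ μ, (((n₃ μ).valMinAbs : ℤ) : ℝ) ^ 2))⁻¹ ^ 5 + ((S : ℝ) ^ 4)⁻¹) * (Real.sqrt (∑ μ, (((n₁ μ).valMinAbs : ℤ) : ℝ) ^ 2))⁻¹ ^ 4 * (Real.sqrt (∑ μ, (((n₂ μ).valMinAbs : ℤ) : ℝ) ^ 2))⁻¹ ^ 4) := by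
  obtain ⟨C₀, hC₀⟩ := torusGreen_hessian_mul_dist_pow_four_le
  obtain ⟨C₁, hC₁⟩ := hC
  refine ⟨108 * (|C₁| + 1) * (4 * |C₀| + 8 * |C₁| + 8) ^ 2, ?_⟩
  intro S _ H hH πK hπK n₁ n₂ n₃ hn₁ hn₂ hn₃
  obtain ⟨M₁, R₁, hs₁, ht₁, hK₁, hA₁, hB₁, hE₁⟩ := site_decomp (hC₀ S) (hC₁ S) H hH hn₁
  obtain ⟨M₂, R₂, hs₂, ht₂, hK₂, hA₂, hB₂, hE₂⟩ := site_decomp (hC₀ S) (hC₁ S) H hH hn₂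
  obtain ⟨M₃, R₃, hs₃, ht₃, hK₃, hA₃, hB₃, hE₃⟩ := site_decomp (hC₀ S) (hC₁ S) H hH hn₃
  -- the plane kernel is `½ K(Hess)` in the enumeration `p1, p2` of the planes
  have hK : ∀ (n : TorusSite 4 S) (a b : Fin 6),
      πK n ⟨(p1 a, p2 a), p1_lt_p2 a⟩ ⟨(p1 b, p2 b), p1_lt_p2 b⟩ =
        (1 / 2 : ℝ) * K (Matrix.of (H n)) a b := by
    intro n a b
    rw [hπK]
    simp only [K, δ, Matrix.of_apply]
  -- the ring as a trace
  have hT : ∑ α, ∑ α', ∑ α'', πK n₁ α α' * πK n₂ α' α'' * πK n₃ α'' α =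
      (1 / 8 : ℝ) * Matrix.trace (K (Matrix.of (H n₁)) * K (Matrix.of (H n₂)) *
        K (Matrix.of (H n₃))) := by
    simp only [sum_planes_eq, hK]
    rw [trace_mul_mul_eq, Finset.mul_sum]
    refine Finset.sum_congr rfl fun a _ => ?_
    rw [Finset.mul_sum]
    refine Finset.sum_congr rfl fun b _ => ?_
    rw [Finset.mul_sum]
    refine Finset.sum_congr rfl fun c _ => ?_
    ring
  -- the symmetric traceless ring vanishes; telescoping remainder
  have htree : Matrix.trace (K M₁ * K M₂ * K M₃) = 0 :=
    treeLevelSkewness_vanishes M₁ M₂ M₃ hs₁ hs₂ hs₃ ht₁ ht₂ ht₃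
  have hdec : Matrix.trace (K (Matrix.of (H n₁)) * K (Matrix.of (H n₂)) * K (Matrix.of (H n₃))) =
      Matrix.trace (K R₁ * K (Matrix.of (H n₂)) * K (Matrix.of (H n₃))) +
        Matrix.trace (K M₁ * K R₂ * K (Matrix.of (H n₃))) +
        Matrix.trace (K M₁ * K M₂ * K R₃) + Matrix.trace (K M₁ * K M₂ * K M₃) := by
    rw [hK₁, hK₂, hK₃]
    simp only [Matrix.add_mul, Matrix.mul_add, Matrix.trace_add]
    ring
  have h1 := abs_trace_mul_mul_le hE₁ hA₂ hA₃
  have h2 := abs_trace_mul_mul_le hB₁ hE₂ hA₃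
  have h3 := abs_trace_mul_mul_le hB₁ hB₂ hE₃
  have habs := (abs_add_three _ _ _).trans (add_le_add_three h1 h2 h3)
  rw [hT, abs_mul, abs_of_pos (by norm_num : (0 : ℝ) < 1 / 8), hdec, htree, add_zero]
  refine (mul_le_mul_of_nonneg_left habs (by norm_num)).trans (le_of_eq ?_)
  ring

end Summit.QuantumFields.YangMills.Theorems.SelfNormalisedSkewness.Negative

end
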